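import Summits.Parity.GeneralizedHardyLittlewood.Theorems.ZDegreeToeplitzBandLemma81ExtAssembly
import Summits.Parity.GeneralizedHardyLittlewood.Theorems.ZDegreeToeplitzBandLemma81ExtShift
import Literature.NumberTheory.LFunctions.Zhang2022.Section4Prop22Eventually

/-!
# Route `ZDegreeToeplitzBand`, crux `PsiGradedTablesClosePoly` (stmt-Parity-22438), line `long_poly_dil`, stub
# `stub_lemma81LongPsiDil` (P2-Dil): the §8 Lemma 8.1 chain RE-RUN AT TWO INDEPENDENT TRUNCATIONS — Part 5 (main):
# LEMMA 8.1 FOR `lhs81Ext` / `Theta1Ext` MODULO THE DATA MEAN SQUARE, for every large `c′`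

Y. Zhang, *Discrete mean estimates and the Landau–Siegel zero*, arXiv:2211.02515v1 — an unrefereed manuscript under
adjudication. **The programme SEARCHES and TYPES; no claim about Landau–Siegel zeros, Theorems 1–2 of arXiv:2211.02515
or a repaired Margin232 until a kernel theorem says so.**

`lemma81Ext_of_meanSquare` (Parts 1–4 composed; `Prop22 c′` an input) and `lemma81Ext_of_meanSquare_eventually`
(`Skeleton.prop22_eventually`): there is `c₀` such that for every `c′ ≥ c₀` there is `C` with, for all large `D` under (A),
all truncations `N₁, N₂ ≤ P³`, all coefficient sequences with `|a₁(n)| ≤ P¹⁰ (n < N₁)`, `|a₂(n)| ≤ P¹⁰ (n < N₂)`, and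
every real `X` bounding the two mean squares `Σ_{Ψ₁}|A_{N₁}(a₁;s)A_{N₂}(a₂;1−s)|²`, `Σ_{Ψ₁}|A_{N₂}(ā₂;s)A_{N₁}(ā₁;1−s)|²`
along `𝔍(α)`:
`‖lhs81Ext c′ χ N₁ N₂ a₁ a₂ − (Theta1Ext c′ χ N₁ N₂ a₁ a₂ + conj Theta1Ext c′ χ N₂ N₁ ā₂ ā₁)‖ ≤ C·𝓛⁻⁹⁶·P·√X + 1`.
This is the whole kernel content of Lemma 8.1's proof with the data-dependent step Z22:§8.u014 factored out as the
parameter `X`: the printed Lemma 8.1 is `X = C·P²𝓛³⁶` (one power of 𝓛 to spare against `𝔓 ≍ P²𝓛⁻⁷⁷`); the slots P2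
(`LongLegSplit.Lemma81LongPsi`) and P2-Dil (`LongLegSplit.Lemma81LongPsiDil`) are the cases `N₁ = Nlong D`, `N₂ = Nsupp D`
and REQUIRE `X = o(P²𝓛³⁸)` resp. `o(D·P²𝓛³⁸)` for their data — the residual statement of the line `long_poly_dil` at
stub 3 (budget memo BUDGET-P2Dil-g20.md on stmt-Parity-22438). Theorems only; no definitions; no new named facts.
Prover: ls-knife-typer-3 g20 (cell landau-siegel §D), `--supports` stmt-Parity-22438.
[cite: Zhang2022LandauSiegel, §8 Lemma 8.1 pp. 42–44]
-/

noncomputable section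

open Complex Real Set ComplexConjugate
open Literature.NumberTheory.LFunctions.Zhang2022
open Literature.NumberTheory.LFunctions.Zhang2022.Skeleton
open Literature.NumberTheory.LFunctions.Zhang2022.Section8aStatements
open Literature.NumberTheory.LFunctions.Zhang2022.KnifeEdge.LongLegSplit

namespace Summit.Parity.GeneralizedHardyLittlewood.Theorems

/-! ### Truncating the coefficients at the truncation changes nothing -/

section Trunc

variable {D : ℕ}

/-- `A_N(a;s,θ)` only sees `a(n)` for `n < N`. [cite: Zhang2022LandauSiegel, §7 p. 13] -/
theorem lemma81Ext_dirPoly_trunc {k : ℕ} (N : ℕ) (a : ℕ → ℂ) (θ : DirichletCharacter ℂ k) (s : ℂ) :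
    Lemma81.dirPoly N (fun n => if n < N then a n else 0) θ s = Lemma81.dirPoly N a θ s := by
  rw [Lemma81.dirPoly_def, Lemma81.dirPoly_def]
  refine Finset.sum_congr rfl fun n hn => ?_
  rw [if_pos (Finset.mem_range.mp hn)]

/-- `lhs81Ext` only sees `a₁(n)`, `n < N₁` and `a₂(n)`, `n < N₂`. [cite: Zhang2022LandauSiegel, §8 Lemma 8.1] -/
theorem lemma81Ext_lhs81Ext_trunc (c' : ℝ) [NeZero D] (χ : DirichletCharacter ℂ D) (N₁ N₂ : ℕ) (a₁ a₂ : ℕ → ℂ) :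
    lhs81Ext c' χ N₁ N₂ (fun n => if n < N₁ then a₁ n else 0) (fun n => if n < N₂ then a₂ n else 0) =
      lhs81Ext c' χ N₁ N₂ a₁ a₂ := by
  unfold lhs81Ext
  refine Finset.sum_congr rfl fun i _ => ?_
  rw [lemma81Ext_dirPoly_trunc, lemma81Ext_dirPoly_trunc]

/-- `Theta1Ext` only sees `a₁(n)`, `n < N₁` and `a₂(n)`, `n < N₂`. [cite: Zhang2022LandauSiegel, §7 Prop. 7.1] -/
theorem lemma81Ext_Theta1Ext_trunc (c' : ℝ) [NeZero D] (χ : DirichletCharacter ℂ D) (N₁ N₂ : ℕ) (a₁ a₂ : ℕ → ℂ) :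
    Theta1Ext c' χ N₁ N₂ (fun n => if n < N₁ then a₁ n else 0) (fun n => if n < N₂ then a₂ n else 0) =
      Theta1Ext c' χ N₁ N₂ a₁ a₂ := by
  unfold Theta1Ext
  refine Finset.sum_congr rfl fun x _ => ?_
  congr 1
  funext s
  rw [lemma81Ext_dirPoly_trunc, lemma81Ext_dirPoly_trunc]

/-- Conjugation commutes with truncation. [folklore] -/
theorem lemma81Ext_conj_trunc (N : ℕ) (a : ℕ → ℂ) :
    (fun n => conj ((fun n => if n < N then a n else 0) n)) = fun n => if n < N then conj (a n) else 0 := by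
  funext n
  by_cases h : n < N
  · simp only [if_pos h]
  · simp only [if_neg h, map_zero]

end Trunc

/-! ### The main theorem -/

variable {c' : ℝ}

/-- **LEMMA 8.1 AT TWO INDEPENDENT TRUNCATIONS, MODULO THE DATA MEAN SQUARE** (`Prop22 c′` an input): Parts 1–4 composed
(`lemma81Ext_of_meanSquare_of_shift` with `hshift := lemma81Ext_shift`), for coefficients bounded by `P¹⁰` below the
truncations (the values at and beyond the truncations are never read). For all large `D`, under (A), all `N₁, N₂ ≤ P³`,
all such `a₁, a₂` and every real `X` bounding the two mean squares along `𝔍(α)`: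
`‖lhs81Ext − (Theta1Ext + conj Theta1Ext′)‖ ≤ C·𝓛⁻⁹⁶·P·√X + 1`. [cite: Zhang2022LandauSiegel, §8 Lemma 8.1 pp. 42–44] -/
theorem lemma81Ext_of_meanSquare (hc' : 0 ≤ c') (h22 : Prop22 c') :
    ∃ C : ℝ, ForAllLarge fun D _ χ => AssumptionA D χ →
      ∀ (N₁ N₂ : ℕ) (a₁ a₂ : ℕ → ℂ) (X : ℝ), (N₁ : ℝ) ≤ bigP D ^ 3 → (N₂ : ℝ) ≤ bigP D ^ 3 →
      (∀ n, n < N₁ → ‖a₁ n‖ ≤ bigP D ^ 10) → (∀ n, n < N₂ → ‖a₂ n‖ ≤ bigP D ^ 10) →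
      (∀ v ∈ Icc (-ell1 D) (ell1 D), ∑ x ∈ finsetOf (PsiOne χ),
          ‖Lemma81.dirPoly N₁ a₁ x.ψ (((alpha D : ℝ) : ℂ) + s0 D + v * I) *
              Lemma81.dirPoly N₂ a₂ x.ψ⁻¹ (1 - (((alpha D : ℝ) : ℂ) + s0 D + v * I))‖ ^ 2 ≤ X) →
      (∀ v ∈ Icc (-ell1 D) (ell1 D), ∑ x ∈ finsetOf (PsiOne χ),
          ‖Lemma81.dirPoly N₂ (fun n => conj (a₂ n)) x.ψ (((alpha D : ℝ) : ℂ) + s0 D + v * I) *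
              Lemma81.dirPoly N₁ (fun n => conj (a₁ n)) x.ψ⁻¹ (1 - (((alpha D : ℝ) : ℂ) + s0 D + v * I))‖ ^ 2 ≤ X) →
        ‖lhs81Ext c' χ N₁ N₂ a₁ a₂ -
            (Theta1Ext c' χ N₁ N₂ a₁ a₂ +
              conj (Theta1Ext c' χ N₂ N₁ (fun n => conj (a₂ n)) fun n => conj (a₁ n)))‖ ≤
          C * ((ell D ^ 96)⁻¹ * bigP D) * Real.sqrt X + 1 := by
  obtain ⟨C, h⟩ := lemma81Ext_of_meanSquare_of_shift hc' h22 (lemma81Ext_shift h22.1 c')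
  refine ⟨C, h.mono fun D _ χ _ _ hS hA N₁ N₂ a₁ a₂ X hN₁ hN₂ ha₁ ha₂ hXA hXB => ?_⟩
  have hP0 : 0 ≤ bigP D ^ 10 := pow_nonneg (Real.exp_pos _).le _
  -- truncate the coefficients; the bounds become global
  set b₁ : ℕ → ℂ := fun n => if n < N₁ then a₁ n else 0 with hb₁
  set b₂ : ℕ → ℂ := fun n => if n < N₂ then a₂ n else 0 with hb₂
  have hb₁b : ∀ n, ‖b₁ n‖ ≤ bigP D ^ 10 := fun n => by
    simp only [hb₁]; split_ifs with h
    · exact ha₁ n h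
    · rw [norm_zero]; exact hP0
  have hb₂b : ∀ n, ‖b₂ n‖ ≤ bigP D ^ 10 := fun n => by
    simp only [hb₂]; split_ifs with h
    · exact ha₂ n h
    · rw [norm_zero]; exact hP0
  have key := hS hA N₁ N₂ b₁ b₂ X hN₁ hN₂ hb₁b hb₂b
    (fun v hv => by simpa only [hb₁, hb₂, lemma81Ext_dirPoly_trunc] using hXA v hv)
    (fun v hv => by
      simpa only [hb₁, hb₂, lemma81Ext_conj_trunc, lemma81Ext_dirPoly_trunc] using hXB v hv)
  rw [hb₁, hb₂, lemma81Ext_lhs81Ext_trunc, lemma81Ext_Theta1Ext_trunc, lemma81Ext_conj_trunc,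
    lemma81Ext_conj_trunc, lemma81Ext_Theta1Ext_trunc] at key
  exact key

/-- **LEMMA 8.1 AT TWO INDEPENDENT TRUNCATIONS, MODULO THE DATA MEAN SQUARE, FOR EVERY LARGE `c′`** (no hypothesis:
`Skeleton.prop22_eventually` supplies Proposition 2.2). [cite: Zhang2022LandauSiegel, §8 Lemma 8.1 pp. 42–44; §2 Prop. 2.2] -/
theorem lemma81Ext_of_meanSquare_eventually :
    ∃ c₀ : ℝ, 0 ≤ c₀ ∧ ∀ c' : ℝ, c₀ ≤ c' →
    ∃ C : ℝ, ForAllLarge fun D _ χ => AssumptionA D χ →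
      ∀ (N₁ N₂ : ℕ) (a₁ a₂ : ℕ → ℂ) (X : ℝ), (N₁ : ℝ) ≤ bigP D ^ 3 → (N₂ : ℝ) ≤ bigP D ^ 3 →
      (∀ n, n < N₁ → ‖a₁ n‖ ≤ bigP D ^ 10) → (∀ n, n < N₂ → ‖a₂ n‖ ≤ bigP D ^ 10) →
      (∀ v ∈ Icc (-ell1 D) (ell1 D), ∑ x ∈ finsetOf (PsiOne χ),
          ‖Lemma81.dirPoly N₁ a₁ x.ψ (((alpha D : ℝ) : ℂ) + s0 D + v * I) *
              Lemma81.dirPoly N₂ a₂ x.ψ⁻¹ (1 - (((alpha D : ℝ) : ℂ) + s0 D + v * I))‖ ^ 2 ≤ X) →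
      (∀ v ∈ Icc (-ell1 D) (ell1 D), ∑ x ∈ finsetOf (PsiOne χ),
          ‖Lemma81.dirPoly N₂ (fun n => conj (a₂ n)) x.ψ (((alpha D : ℝ) : ℂ) + s0 D + v * I) *
              Lemma81.dirPoly N₁ (fun n => conj (a₁ n)) x.ψ⁻¹ (1 - (((alpha D : ℝ) : ℂ) + s0 D + v * I))‖ ^ 2 ≤ X) →
        ‖lhs81Ext c' χ N₁ N₂ a₁ a₂ -
            (Theta1Ext c' χ N₁ N₂ a₁ a₂ +
              conj (Theta1Ext c' χ N₂ N₁ (fun n => conj (a₂ n)) fun n => conj (a₁ n)))‖ ≤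
          C * ((ell D ^ 96)⁻¹ * bigP D) * Real.sqrt X + 1 := by
  obtain ⟨c₀, h0, h⟩ := prop22_eventually
  exact ⟨c₀, h0, fun c' hc' => lemma81Ext_of_meanSquare (h0.trans hc') (h c' hc')⟩

end Summit.Parity.GeneralizedHardyLittlewood.Theorems

end
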